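import Literature.AlgebraicGeometry.Resolution.AlterationsLemma411Projection
import Literature.AlgebraicGeometry.Resolution.BlowupsFlatBaseChange
import Literature.AlgebraicGeometry.Resolution.BlowupsGlue
import Literature.AlgebraicGeometry.Resolution.MarkedIdealsEtale
import Literature.AlgebraicGeometry.Resolution.NormalCrossingsLocal
import Literature.AlgebraicGeometry.Resolution.SmoothStalksRegular
import HarnessLib

/-!
# De Jong's alteration theorem, proof of Lemma 4.11: `X'` is the blowing up of `X` in `π⁻¹(p)`

Topic: `Literature/AlgebraicGeometry/Resolution`. DISCHARGES the named fact
`DeJong1996Lemma411Blowup` of `AlterationsLemma411Projection.lean` — Lemma 4.11 (i) of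
de Jong 1996 for the construction `X' = X ×_{ℙ^{d+1}} P̃`, `φ = pr₁`:

> "Choose `p` and put `X' = {(x, ℓ) ∈ X × ℙ^{d-1} | π(x) ∈ ℓ}`. It is easy to see that `X'`
> equals the blowing up of `X` in the finite set `π⁻¹(p)`, which is contained in the regular
> locus of `X` (since `p ∉ B`) and disjoint from `Z` (since `p ∉ π(Z)`)." (p. 68)

The proof is written for a diagram `X —π→ T ←b— P` of schemes with `b` a blowing up of `T` in
the reduced closed point `p` (`IsBlowup`, universal property) and `π` étale over an open
`V ∋ p` (in 4.11: `T = ℙ^{d+1}`, `b : P̃ → ℙ^{d+1}`):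

* `Scheme.Hom.ker_eq_vanishingIdeal_of_isReduced` — the kernel (scheme-theoretic image ideal)
  of a quasi-compact morphism with reduced source is the (radical) ideal sheaf of the closure of
  its image; `eq_vanishingIdeal_support_of_isRadical` — a radical ideal sheaf is the vanishing
  ideal sheaf of its support;
* `comap_vanishingIdeal_singleton_of_isReduced_fiber` — **`π^* 𝓘_p = 𝓘_{π⁻¹(p)}` when the
  fibre `π⁻¹(p)` is reduced** (e.g. `π` étale over a neighbourhood of `p`): the pulled-back
  ideal is the kernel of the fibre inclusion (`ker_fst_of_isClosedImmersion`); vanishing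
  ideal sheaves restrict to opens (`comap_vanishingIdeal_of_isOpenImmersion`,
  `NormalCrossingsLocal.lean`);
* `isPullback_restrict_pullback` — the square `φ⁻¹U → P` over `U → T` is cartesian, for
  `φ = pr₁ : X ×_T P → X` and `U ⊆ X` open; `isIso_fst_morphismRestrict_of_isIso` — `φ` is an
  isomorphism over `π⁻¹(O)` if `b` is over `O`;
* `isBlowup_fst_vanishingIdeal_preimage` — **`φ = pr₁ : X ×_T P → X` is the blowing up of
  `X` in `π⁻¹(p)`**: over `π⁻¹V` by flat base change of `b` along the étale `π⁻¹V → T`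
  (`IsBlowup.of_isPullback_of_flat`) and the ideal identity above, over `X ∖ π⁻¹(p)` because
  `φ` is an isomorphism there and `𝓘_{π⁻¹(p)}` is the unit ideal, glued by
  `IsBlowup.of_openCover`;
* `mem_regularLocus_of_etale_morphismRestrict` — `π⁻¹(p) ⊆ Reg(X)` if `T` is regular at `p`
  (regularity ascends along étale morphisms, Matsumura 23.7,
  `isRegularLocalRing_stalk_iff_of_etale`);
  `isClosed_singleton_of_mem_preimage` — the points of the finite discrete closed fibre are
  closed;
* `DeJong1996Lemma411Blowup_holds` — the named fact DISCHARGED (`ℙ^{d+1}_k` is regular,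
  `isRegular_projectiveSpace`).

## Sources

* A. J. de Jong, *Smoothness, semi-stability and alterations*, Publ. Math. IHÉS 83 (1996),
  Lemma 4.11 (i) and its proof, pp. 67–68. [DeJong1996]
* U. Görtz, T. Wedhorn, *Algebraic Geometry I*, 2nd ed. (2020), Prop. 13.91 (blowing up and flat
  base change; locality). [GortzWedhorn2020]
* H. Matsumura, *Commutative Ring Theory* (1986), Thm. 23.7. [Matsumura1987]
-/

noncomputable section

open CategoryTheory CategoryTheory.Limits AlgebraicGeometry TopologicalSpace Topology

namespace Literature.AlgebraicGeometry.Resolution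

universe u

/-! ## Radical ideal sheaves and kernels of morphisms with reduced source -/

/-- A radical ideal sheaf is the vanishing ideal sheaf of its support (the global form of
`I = √I = I(V(I))`). [folklore] -/
theorem eq_vanishingIdeal_support_of_isRadical {X : Scheme.{u}} (I : X.IdealSheafData)
    (h : ∀ U : X.affineOpens, (I.ideal U).IsRadical) :
    I = Scheme.IdealSheafData.vanishingIdeal I.support := by
  rw [Scheme.IdealSheafData.vanishingIdeal_support]
  refine le_antisymm I.le_radical fun U => ?_
  change (I.ideal U).radical ≤ I.ideal U
  exact (h U).radical.le

/-- **The kernel of a quasi-compact morphism with reduced source is the ideal sheaf of the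
closure of its image**: scheme-theoretic images of reduced schemes are reduced (Stacks 056B).
[folklore] -/
theorem Scheme.Hom.ker_eq_vanishingIdeal_of_isReduced {W Y : Scheme.{u}} (h : W ⟶ Y)
    [QuasiCompact h] [IsReduced W] :
    h.ker = Scheme.IdealSheafData.vanishingIdeal ⟨closure (Set.range h), isClosed_closure⟩ := by
  have hrad : ∀ U : Y.affineOpens, (h.ker.ideal U).IsRadical := by
    intro U x hx
    obtain ⟨n, hn⟩ := hx
    rw [Scheme.Hom.ker_apply] at hn ⊢
    rw [RingHom.mem_ker] at hn ⊢
    rw [map_pow] at hn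
    exact IsNilpotent.eq_zero ⟨n, hn⟩
  have hs : h.ker.support = ⟨closure (Set.range h), isClosed_closure⟩ :=
    TopologicalSpace.Closeds.ext (Scheme.Hom.support_ker h)
  rw [eq_vanishingIdeal_support_of_isRadical h.ker hrad, hs]

/-- The ideal sheaf of the reduced closed point `p` is the kernel of `Spec κ(p) → T`.
[folklore] -/
theorem ker_fromSpecResidueField_eq_vanishingIdeal {T : Scheme.{u}} {p : T}
    (hp : IsClosed ({p} : Set T)) :
    (T.fromSpecResidueField p).ker = Scheme.IdealSheafData.vanishingIdeal ⟨{p}, hp⟩ := by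
  haveI : IsClosedImmersion (T.fromSpecResidueField p) :=
    isClosed_singleton_iff_isClosedImmersion.mp hp
  rw [Scheme.Hom.ker_eq_vanishingIdeal_of_isReduced]
  congr 1
  apply TopologicalSpace.Closeds.ext
  change closure (Set.range (T.fromSpecResidueField p)) = {p}
  rw [Scheme.range_fromSpecResidueField, hp.closure_eq]

/-- **`π^* 𝓘_p = 𝓘_{π⁻¹(p)}` when the fibre over `p` is reduced**: for a morphism `g : W → T`,
a closed point `p ∈ T` and the ideal sheaf `𝓘_p` of the reduced closed subscheme `{p}`, if the
scheme-theoretic fibre `g⁻¹(p) = W ×_T Spec κ(p)` is reduced (e.g. `g` étale, or merely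
unramified, at the points over `p`) then the pulled-back ideal sheaf `g^* 𝓘_p` (Mathlib's
`comap`: the ideal of the closed subscheme `W ×_T {p}`) is the ideal sheaf of the reduced closed
subscheme `g⁻¹(p)`. [folklore] -/
theorem comap_vanishingIdeal_singleton_of_isReduced_fiber {W T : Scheme.{u}} (g : W ⟶ T)
    {p : T} (hp : IsClosed ({p} : Set T)) [IsReduced (g.fiber p)] :
    (Scheme.IdealSheafData.vanishingIdeal ⟨{p}, hp⟩).comap g =
      Scheme.IdealSheafData.vanishingIdeal ⟨g ⁻¹' {p}, hp.preimage g.continuous⟩ := by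
  haveI : IsClosedImmersion (T.fromSpecResidueField p) :=
    isClosed_singleton_iff_isClosedImmersion.mp hp
  haveI : QuasiCompact (g.fiberι p) := by
    delta Scheme.Hom.fiberι Scheme.Hom.fiber
    infer_instance
  rw [← ker_fromSpecResidueField_eq_vanishingIdeal hp,
    ← Scheme.IdealSheafData.ker_fst_of_isClosedImmersion]
  change (g.fiberι p).ker = _
  rw [Scheme.Hom.ker_eq_vanishingIdeal_of_isReduced]
  congr 1
  apply TopologicalSpace.Closeds.ext
  change closure (Set.range (g.fiberι p)) = g ⁻¹' {p}
  rw [Scheme.Hom.range_fiberι, (hp.preimage g.continuous).closure_eq]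

/-! ## Fibres of étale morphisms are reduced -/

/-- The scheme-theoretic fibre of an étale morphism over any point is reduced: it is étale,
in particular smooth, over the residue field (`isReduced_of_smooth`). [folklore] -/
theorem isReduced_fiber_of_etale {W T : Scheme.{u}} (g : W ⟶ T) [Etale g] (p : T) :
    IsReduced (g.fiber p) := by
  haveI : Etale (g.fiberToSpecResidueField p) := by
    delta Scheme.Hom.fiberToSpecResidueField Scheme.Hom.fiber
    infer_instance
  have hsm : Smooth (g.fiberToSpecResidueField p) := inferInstance
  exact @isReduced_of_smooth (T.residueField p) _ (g.fiber p) (g.fiberToSpecResidueField p) hsm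

/-! ## The base change `X' = X ×_T P` over opens of `X` -/

section Construction

variable {X T P : Scheme.{u}} (π : X ⟶ T) (b : P ⟶ T)

/-- For `φ = pr₁ : X ×_T P → X` and an open `U ⊆ X`, the square with top `φ⁻¹U → P` (the
restriction of `pr₂`), left `φ|_U : φ⁻¹U → U`, right `b` and bottom `U → X → T` is cartesian
(pasting `φ⁻¹U = U ×_X (X ×_T P)`). [folklore] -/
theorem isPullback_restrict_pullback (U : X.Opens) :
    IsPullback ((pullback.fst π b ⁻¹ᵁ U).ι ≫ pullback.snd π b) (pullback.fst π b ∣_ U) b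
      (U.ι ≫ π) :=
  (isPullback_morphismRestrict (pullback.fst π b) U).flip.paste_horiz
    (IsPullback.of_hasPullback π b).flip

/-- **`φ = pr₁` is an isomorphism over `π⁻¹(O)` if `b` is an isomorphism over `O`** (`O ⊆ T`
open): `φ|_{π⁻¹O}` is a base change of `b|_O`. [folklore] -/
theorem isIso_fst_morphismRestrict_of_isIso (O : T.Opens) [IsIso (b ∣_ O)] :
    IsIso (pullback.fst π b ∣_ π ⁻¹ᵁ O) := by
  set φ := pullback.fst π b with hφ
  let W : (pullback π b).Opens := φ ⁻¹ᵁ (π ⁻¹ᵁ O)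
  have sq := isPullback_restrict_pullback π b (π ⁻¹ᵁ O)
  -- factor the top map through `b⁻¹(O)`
  have hrange : Set.range (W.ι ≫ pullback.snd π b) ⊆ Set.range (b ⁻¹ᵁ O).ι := by
    rintro _ ⟨w, rfl⟩
    rw [Scheme.Opens.range_ι]
    change b (pullback.snd π b (W.ι w)) ∈ O
    rw [← Scheme.Hom.comp_apply, ← pullback.condition, Scheme.Hom.comp_apply]
    exact w.2
  let h₁₁ : (W : Scheme.{u}) ⟶ (b ⁻¹ᵁ O : Scheme.{u}) :=
    IsOpenImmersion.lift (b ⁻¹ᵁ O).ι (W.ι ≫ pullback.snd π b) hrange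
  have hfac : h₁₁ ≫ (b ⁻¹ᵁ O).ι = W.ι ≫ pullback.snd π b := IsOpenImmersion.lift_fac _ _ _
  have t : IsPullback (b ⁻¹ᵁ O).ι (b ∣_ O) b O.ι := (isPullback_morphismRestrict b O).flip
  have s : IsPullback (h₁₁ ≫ (b ⁻¹ᵁ O).ι) (φ ∣_ π ⁻¹ᵁ O) b ((π ∣_ O) ≫ O.ι) := by
    rw [hfac, morphismRestrict_ι]
    exact sq
  have hp : h₁₁ ≫ (b ∣_ O) = (φ ∣_ π ⁻¹ᵁ O) ≫ (π ∣_ O) := by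
    rw [← cancel_mono O.ι, Category.assoc, Category.assoc, morphismRestrict_ι, morphismRestrict_ι,
      ← Category.assoc, hfac, ← Category.assoc, morphismRestrict_ι, Category.assoc,
      Category.assoc, pullback.condition]
  have result : IsPullback h₁₁ (φ ∣_ π ⁻¹ᵁ O) (b ∣_ O) (π ∣_ O) := IsPullback.of_right s hp t
  have : (MorphismProperty.isomorphisms Scheme.{u}) (φ ∣_ π ⁻¹ᵁ O) :=
    MorphismProperty.of_isPullback (P := MorphismProperty.isomorphisms Scheme.{u}) result
      ((MorphismProperty.isomorphisms.iff _).mpr inferInstance)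
  exact (MorphismProperty.isomorphisms.iff _).mp this

/-- **`X' = X ×_T P → X` is the blowing up of `X` in `π⁻¹(p)`** (de Jong 1996, proof of 4.11:
"`X'` equals the blowing up of `X` in the finite set `π⁻¹(p)`"): if `b : P → T` is a blowing
up of `T` along the ideal sheaf `𝓘_p` of the reduced closed point `p` and `π : X → T` is étale
over an open neighbourhood `V` of `p`, then `φ = pr₁ : X ×_T P → X` is a blowing up of `X` along
the ideal sheaf `𝓘_S` of the reduced closed subscheme `S = π⁻¹(p)`. Over `π⁻¹V`, `φ` is the
base change of `b` along the flat `π⁻¹V → T`, hence the blowing up along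
`π^*𝓘_p = 𝓘_S` there (the fibre of the étale `π⁻¹V → T` over `p` is reduced); over
`X ∖ S = π⁻¹(T ∖ {p})`, `φ` is an isomorphism (as `b` is over `T ∖ {p}`) and `𝓘_S` is the
unit ideal; being a blowing up is local on the base.
[cite: DeJong1996, Lemma 4.11 (proof), p. 68] -/
theorem isBlowup_fst_vanishingIdeal_preimage {p : T} (hp : IsClosed ({p} : Set T))
    (hb : IsBlowup b (Scheme.IdealSheafData.vanishingIdeal ⟨{p}, hp⟩)) (V : T.Opens)
    (hpV : p ∈ V) [Etale (π ∣_ V)] :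
    IsBlowup (pullback.fst π b)
      (Scheme.IdealSheafData.vanishingIdeal ⟨π ⁻¹' {p}, hp.preimage π.continuous⟩) := by
  set φ := pullback.fst π b with hφ
  set I : X.IdealSheafData :=
    Scheme.IdealSheafData.vanishingIdeal ⟨π ⁻¹' {p}, hp.preimage π.continuous⟩ with hI
  -- the two opens `U₁ = π⁻¹V`, `U₂ = π⁻¹(T ∖ {p})`
  let O : T.Opens := ⟨{p}ᶜ, hp.isOpen_compl⟩
  let U : Bool → X.Opens := fun i => cond i (π ⁻¹ᵁ V) (π ⁻¹ᵁ O)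
  have hU : ⨆ i, U i = ⊤ := by
    rw [eq_top_iff]
    rintro x -
    rw [Opens.mem_iSup]
    by_cases hx : π x = p
    · exact ⟨true, show π x ∈ V by rw [hx]; exact hpV⟩
    · exact ⟨false, show π x ∈ ({p}ᶜ : Set T) from hx⟩
  let 𝒰 : X.OpenCover := X.openCoverOfIsOpenCover U hU
  refine IsBlowup.of_openCover 𝒰 fun i => ?_
  change IsBlowup (φ ∣_ (U i).ι.opensRange) (I.comap (U i).ι.opensRange.ι)
  rw [Scheme.Opens.opensRange_ι]
  cases i with
  | true =>
    -- over `π⁻¹V`: flat base change of `b` along the étale `π⁻¹V → T`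
    change IsBlowup (φ ∣_ π ⁻¹ᵁ V) (I.comap (π ⁻¹ᵁ V).ι)
    have h1 : Etale ((π ⁻¹ᵁ V).ι ≫ π) := by
      rw [← morphismRestrict_ι]
      infer_instance
    have hB : IsBlowup (φ ∣_ π ⁻¹ᵁ V)
        ((Scheme.IdealSheafData.vanishingIdeal ⟨{p}, hp⟩).comap ((π ⁻¹ᵁ V).ι ≫ π)) :=
      hb.of_isPullback_of_flat (isPullback_restrict_pullback π b (π ⁻¹ᵁ V))
    haveI := isReduced_fiber_of_etale ((π ⁻¹ᵁ V).ι ≫ π) p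
    rw [comap_vanishingIdeal_singleton_of_isReduced_fiber ((π ⁻¹ᵁ V).ι ≫ π) hp] at hB
    have hZ : (⟨π ⁻¹' {p}, hp.preimage π.continuous⟩ : Closeds X).preimage
        (π ⁻¹ᵁ V).ι.continuous =
        ⟨((π ⁻¹ᵁ V).ι ≫ π) ⁻¹' {p}, hp.preimage ((π ⁻¹ᵁ V).ι ≫ π).continuous⟩ := by
      apply TopologicalSpace.Closeds.ext
      ext x
      simp only [TopologicalSpace.Closeds.coe_preimage, TopologicalSpace.Closeds.coe_mk,
        Set.mem_preimage, Set.mem_singleton_iff, Scheme.Hom.comp_apply]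
    rw [hI, comap_vanishingIdeal_of_isOpenImmersion, hZ]
    exact hB
  | false =>
    -- over `π⁻¹(T ∖ {p})`: `φ` is an isomorphism and `𝓘_S` is the unit ideal
    change IsBlowup (φ ∣_ π ⁻¹ᵁ O) (I.comap (π ⁻¹ᵁ O).ι)
    haveI : IsIso (b ∣_ O) := hb.isIso_morphismRestrict (U := O) (by
      rw [Scheme.IdealSheafData.coe_support_vanishingIdeal]
      exact disjoint_compl_left)
    haveI : IsIso (φ ∣_ π ⁻¹ᵁ O) := isIso_fst_morphismRestrict_of_isIso π b O
    have htop : I.comap (π ⁻¹ᵁ O).ι = ⊤ := by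
      rw [← Scheme.IdealSheafData.support_eq_bot_iff, Scheme.IdealSheafData.support_comap, hI]
      ext x
      simp only [TopologicalSpace.Closeds.coe_preimage, Set.mem_preimage,
        Scheme.IdealSheafData.coe_support_vanishingIdeal, TopologicalSpace.Closeds.coe_mk,
        TopologicalSpace.Closeds.coe_bot, Set.mem_empty_iff_false, iff_false]
      exact x.2
    rw [htop]
    have := (IsBlowup.id (isEffectiveCartier_top (X := (π ⁻¹ᵁ O : Scheme.{u})))).iso_comp
      (asIso (φ ∣_ π ⁻¹ᵁ O))
    simpa using this

end Construction

/-! ## The fibre `π⁻¹(p)`: closed points, regular points -/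

/-- The points of the fibre of a locally quasi-finite morphism over a closed point are closed:
the fibre is a closed, discrete subspace. [folklore] -/
theorem isClosed_singleton_of_mem_preimage {X T : Scheme.{u}} (π : X ⟶ T) [LocallyQuasiFinite π]
    {p : T} (hp : IsClosed ({p} : Set T)) {s : X} (hs : s ∈ π ⁻¹' {p}) :
    IsClosed ({s} : Set X) := by
  have hS : IsClosed (π ⁻¹' {p}) := hp.preimage π.continuous
  have hdisc := π.isDiscrete_preimage_singleton p
  rw [isDiscrete_iff_discreteTopology] at hdisc
  apply isClosed_of_closure_subset
  intro t ht
  have htS : t ∈ π ⁻¹' {p} := hS.closure_subset_iff.mpr (Set.singleton_subset_iff.mpr hs) ht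
  have hst : s ⤳ t := specializes_iff_mem_closure.mpr ht
  have h : (⟨s, hs⟩ : π ⁻¹' {p}) ⤳ ⟨t, htS⟩ := by
    rw [subtype_specializes_iff]
    exact hst
  have := congrArg Subtype.val h.eq
  exact (Set.mem_singleton_iff.mpr this.symm)

/-- **`π⁻¹(p) ⊂ Reg(X)` since `p ∉ B`**: if `π` is étale over the open `V ∋ p` of the locally
Noetherian scheme `T` and `T` is regular at `p`, then `X` is regular at every point over `p`
(regularity ascends along étale local homomorphisms, Matsumura Thm. 23.7).
[cite: Matsumura1987, Thm. 23.7] -/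
theorem mem_regularLocus_of_etale_morphismRestrict {X T : Scheme.{u}} (π : X ⟶ T)
    [IsLocallyNoetherian T] [IsLocallyNoetherian X] (V : T.Opens) [Etale (π ∣_ V)] {p : T}
    (hpV : p ∈ V) (hreg : p ∈ Scheme.regularLocus T) {s : X} (hs : π s = p) :
    s ∈ Scheme.regularLocus X := by
  have hsV : s ∈ π ⁻¹ᵁ V := show π s ∈ V by rw [hs]; exact hpV
  have e : V.ι ((π ∣_ V) ⟨s, hsV⟩) = p := by
    rw [← Scheme.Hom.comp_apply, morphismRestrict_ι, Scheme.Hom.comp_apply]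
    exact hs
  have h2 : (π ∣_ V) ⟨s, hsV⟩ ∈ Scheme.regularLocus (V : Scheme.{u}) :=
    (mem_regularLocus_iff_of_flat_of_isPreimmersion V.ι _).mpr (by rw [e]; exact hreg)
  have h1 := (isRegularLocalRing_stalk_iff_of_etale (π ∣_ V) ⟨s, hsV⟩).mpr h2
  exact (mem_regularLocus_iff_of_flat_of_isPreimmersion (π ⁻¹ᵁ V).ι ⟨s, hsV⟩).mp h1

/-! ## (i) discharged -/

open Literature.AlgebraicGeometry.Motives (projectiveSpace) in
/-- **`DeJong1996Lemma411Blowup` DISCHARGED** (de Jong 1996, Lemma 4.11 (i) for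
`X' = X ×_{ℙ^{d+1}} P̃`, `φ = pr₁`): with `S = π⁻¹(p)` — closed, finite (`π` is finite),
consisting of closed points (`isClosed_singleton_of_mem_preimage`), contained in `Reg(X)`
(`ℙ^{d+1}_k` is regular, `isRegular_projectiveSpace`, and `π` is étale over `V ∋ p`,
`mem_regularLocus_of_etale_morphismRestrict`), disjoint from `Z` (`p ∉ π(Z)`) — the morphism
`φ` is the blowing up of `X` in `S` (`isBlowup_fst_vanishingIdeal_preimage`).
[cite: DeJong1996, Lemma 4.11 (i) and proof, pp. 67–68] -/
theorem DeJong1996Lemma411Blowup_holds : DeJong1996Lemma411Blowup.{u} := by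
  intro k _ _ X fX Z d π p P b q hπ hM
  obtain ⟨V, hpV, hV⟩ := hπ.exists_etale_morphismRestrict
  haveI := hV
  haveI := hπ.isFinite
  have hp := hM.isClosed_singleton
  haveI : IsProper (projectiveSpace (d + 1) k).hom :=
    Literature.AlgebraicGeometry.Motives.isProper_projectiveSpace (d + 1) k
  haveI : IsLocallyNoetherian (projectiveSpace (d + 1) k).left :=
    LocallyOfFiniteType.isLocallyNoetherian (projectiveSpace (d + 1) k).hom
  haveI : IsLocallyNoetherian X := LocallyOfFiniteType.isLocallyNoetherian π
  refine ⟨hp.preimage π.continuous, π.finite_preimage_singleton p,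
    fun s hs => isClosed_singleton_of_mem_preimage π hp hs, fun s hs => ?_, ?_,
    isBlowup_fst_vanishingIdeal_preimage π b hp hM.isBlowup V hpV⟩
  · exact mem_regularLocus_of_etale_morphismRestrict π V hpV
      (isRegular_projectiveSpace (n := d + 1) (k := k) p) hs
  · rw [Set.disjoint_left]
    intro s hs hsZ
    exact hπ.notMem_image ⟨s, hsZ, hs⟩

end Literature.AlgebraicGeometry.Resolution

end
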